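import Summits.SmoothPoincare4.SmoothPoincare4.Theorems.ConvexBisectionAcyclicBisectionExistsSeamTwistSignPageDet
import Summits.SmoothPoincare4.SmoothPoincare4.Theorems.ConvexBisectionAcyclicBisectionExistsPageTwistingTransverseLoop
import HarnessLib

/-!
# Seam transport, ST4 (4b, calculus): the ambient differential of a map of the Lefschetz base and
# the frame data of fibred maps
(wave 5, brick X3-2b of sub-node ST4 `node_ST4_twistSign` of node T3c-2 `node_seam_transport` of
stub `stub_T3_dualPresentation` (T3), line `modp-braid-orbits`, crux
`ConvexBisection.AcyclicBisectionExists`, item stmt-SmoothPoincare4-10508; registered sub-goal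
`helper_ambDeriv_fibred`)

Tangent vectors of `Base g ⊂ ℂ² = ℝ⁴` are read in the preferred charts; `ambient g x = d(incl)_x`
(`LefschetzBasePages.lean` §6) turns them into vectors of `ℝ⁴`, injectively (`injective_ambient`),
hence bijectively (`ambientEquiv`).  For a map `f : Base g → Base g` the AMBIENT DIFFERENTIAL at `x`
is the honest `4 × 4` matrix `ambDeriv g f x = ambient_{f x} ∘ df_x ∘ ambient_x⁻¹ : ℝ⁴ →L ℝ⁴` — chart
independent, multiplicative (`ambDeriv_comp`), equal to `fderiv φ` when `f` is the restriction of a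
map `φ` of `ℝ⁴` (`ambDeriv_eq_fderiv`), injective for local diffeomorphisms.  For a FIBRED map
(`rho ∘ f = rho`, `w ∘ f ∈ ℝ_{>0} · w`) it preserves `d rho` (`fderiv_rho_ambDeriv`: tangent vectors of
`∂ Base g` go to tangent vectors of `∂ Base g`) and scales the angular form:
`Im (w̄(f x) dΦ_{f x}(Λ X)) = r² Im (w̄(x) dΦ_x(X))` with `w (f x) = r w x`, `r > 0`
(`angle_ambDeriv`; differentiate `Im (w(f y) · w̄(y)) ≡ 0` on the manifold `Base g`).  Consequently
(`helper_ambDeriv_fibred`, §4) at a flat page point `x` with flat image: `Λ = ambDeriv g f x` maps the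
page line `L_x` into `L_{f x}`, pairs positively with the horizontal normals
(`⟪Λ X, n(f x)⟫ = κ ⟪X, n(x)⟫`, `κ > 0`, for `X` tangent to `∂ Base g`) — the two inputs of the
upper-triangular frame relation of ST4 — and, for a local diffeomorphism `f`, has non-vanishing page
determinant.  §5: along an ambient isotopy `R` the matrices `t ↦ ambDeriv g (R t) x` at a FIXED point
depend continuously on `t` (tangent map of `(t, y) ↦ R t y` on a constant section).

Everything is proved; no named facts, no `sorry`.  References: J. B. Etnyre, T. Fuller, IMRN 2006,
Thm. 1 (proof, p. 8) [EtnyreFuller2006]; J. M. Lee, *Introduction to Smooth Manifolds* (2013),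
Prop. 3.9, Cor. 5.30 [LeeSmoothManifolds2013].
-/

noncomputable section

set_option linter.dupNamespace false

open scoped Manifold ContDiff Topology ComplexConjugate Bundle
open Set Function Complex Bundle
open Literature.Topology.FourManifolds Literature.Topology.FourManifolds.LefschetzBase

namespace Summit.SmoothPoincare4.SmoothPoincare4.Theorems.AcyclicBisectionExists.ModpBraidOrbits

variable {g : ℕ}

/-! ## §1 `ambient` as a linear isomorphism of `ℝ⁴` -/

/-- `ambient g x` as a continuous linear map: the differential of the inclusion `Base g ↪ ℝ⁴`.
[folklore] -/
def ambientCLM (g : ℕ) (x : Base g) : EuclideanSpace ℝ (Fin 4) →L[ℝ] EuclideanSpace ℝ (Fin 4) :=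
  mfderiv (𝓡∂ 4) (𝓡 4) (RegularSublevel.incl (isRegularLevel_rho g)) x

/-- `ambientCLM` is `ambient` (definitional). [folklore] -/
@[simp] theorem ambientCLM_apply (x : Base g) (v : EuclideanSpace ℝ (Fin 4)) :
    ambientCLM g x v = ambient g x v := rfl

/-- **`ambient g x` is a linear isomorphism of `ℝ⁴`** (an injective endomorphism of a
finite-dimensional space). [folklore] -/
def ambientEquiv (g : ℕ) (x : Base g) : EuclideanSpace ℝ (Fin 4) ≃L[ℝ] EuclideanSpace ℝ (Fin 4) :=
  LinearEquiv.toContinuousLinearEquiv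
    (LinearEquiv.ofInjectiveEndo (ambientCLM g x).toLinearMap (injective_ambient x))

/-- `ambientEquiv` is `ambient` (definitional). [folklore] -/
@[simp] theorem ambientEquiv_apply (x : Base g) (v : EuclideanSpace ℝ (Fin 4)) :
    ambientEquiv g x v = ambient g x v := rfl

/-- `ambient ∘ ambient⁻¹ = id`. [folklore] -/
@[simp] theorem ambient_symm_apply (x : Base g) (X : EuclideanSpace ℝ (Fin 4)) :
    ambient g x ((ambientEquiv g x).symm X) = X :=
  (ambientEquiv g x).apply_symm_apply X

/-- `ambient⁻¹ ∘ ambient = id`. [folklore] -/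
@[simp] theorem symm_ambient_apply (x : Base g) (v : EuclideanSpace ℝ (Fin 4)) :
    (ambientEquiv g x).symm (ambient g x v) = v :=
  (ambientEquiv g x).symm_apply_apply v

/-- At a boundary point, the `0`-th chart coordinate of `ambient⁻¹ X` is `-d rho (X)`; in particular
vectors of `ℝ⁴` tangent to `{rho = 1/4}` correspond to the boundary hyperplane `{v₀ = 0}` of the
chart. [folklore] -/
theorem ambientEquiv_symm_apply_zero (x : Base g) (hx : rho g x.1 = 1 / 4)
    (X : EuclideanSpace ℝ (Fin 4)) :
    (ambientEquiv g x).symm X 0 = -fderiv ℝ (rho g) x.1 X := by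
  have h := fderiv_rho_ambient x hx ((ambientEquiv g x).symm X)
  rw [ambient_symm_apply] at h
  linarith

/-- The inclusion `Base g ↪ ℝ⁴` has differential `ambientCLM`. [folklore] -/
theorem hasMFDerivAt_incl_base (x : Base g) :
    HasMFDerivAt (𝓡∂ 4) (𝓡 4) (RegularSublevel.incl (isRegularLevel_rho g)) x (ambientCLM g x) :=
  ((RegularSublevel.contMDiff_incl (isRegularLevel_rho g)).mdifferentiableAt (by simp)).hasMFDerivAt

/-! ## §2 The ambient differential of a map of the base -/

/-- **The ambient differential** of `f : Base g → Base g` at `x`: the `4 × 4` matrix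
`ambient_{f x} ∘ df_x ∘ ambient_x⁻¹` of `ℝ⁴` (chart independent). [cite: LeeSmoothManifolds2013, Prop. 3.9] -/
def ambDeriv (g : ℕ) (f : Base g → Base g) (x : Base g) :
    EuclideanSpace ℝ (Fin 4) →L[ℝ] EuclideanSpace ℝ (Fin 4) :=
  (ambientCLM g (f x)).comp ((mfderiv (𝓡∂ 4) (𝓡∂ 4) f x).comp
    (ambientEquiv g x).symm.toContinuousLinearMap)

/-- Unfolding the ambient differential. [folklore] -/
theorem ambDeriv_apply (f : Base g → Base g) (x : Base g) (X : EuclideanSpace ℝ (Fin 4)) :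
    ambDeriv g f x X = ambient g (f x) (mfderiv (𝓡∂ 4) (𝓡∂ 4) f x ((ambientEquiv g x).symm X)) :=
  rfl

/-- **The ambient differential on ambient vectors**: `Λ (ambient v) = ambient (df v)`. [folklore] -/
theorem ambDeriv_ambient (f : Base g → Base g) (x : Base g) (v : EuclideanSpace ℝ (Fin 4)) :
    ambDeriv g f x (ambient g x v) = ambient g (f x) (mfderiv (𝓡∂ 4) (𝓡∂ 4) f x v) := by
  rw [ambDeriv_apply, symm_ambient_apply]

/-- The ambient differential on ambient vectors is the differential of `incl ∘ f`. [folklore] -/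
theorem ambDeriv_ambient_eq_mfderiv {f : Base g → Base g} {x : Base g}
    (hf : MDifferentiableAt (𝓡∂ 4) (𝓡∂ 4) f x) (v : EuclideanSpace ℝ (Fin 4)) :
    ambDeriv g f x (ambient g x v) =
      mfderiv (𝓡∂ 4) (𝓡 4) (RegularSublevel.incl (isRegularLevel_rho g) ∘ f) x v := by
  rw [ambDeriv_ambient, mfderiv_comp x ((RegularSublevel.contMDiff_incl
    (isRegularLevel_rho g)).mdifferentiableAt (by simp)) hf]
  rfl

/-- **Chain rule**: `ambDeriv (f ∘ h) x = ambDeriv f (h x) ∘ ambDeriv h x`. [cite: LeeSmoothManifolds2013, Prop. 3.9] -/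
theorem ambDeriv_comp {f h : Base g → Base g} {x : Base g}
    (hf : MDifferentiableAt (𝓡∂ 4) (𝓡∂ 4) f (h x)) (hh : MDifferentiableAt (𝓡∂ 4) (𝓡∂ 4) h x) :
    ambDeriv g (f ∘ h) x = (ambDeriv g f (h x)).comp (ambDeriv g h x) := by
  ext1 X
  rw [ContinuousLinearMap.comp_apply, ambDeriv_apply, ambDeriv_apply h x X, ambDeriv_ambient,
    mfderiv_comp x hf hh]
  rfl

/-- **A restriction of a map of `ℝ⁴` has ambient differential its Fréchet derivative**: if
`(f y).1 = φ y.1` for all `y`, `f` differentiable at `x` and `φ` at `x.1`, then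
`ambDeriv g f x = fderiv φ x.1`. [cite: LeeSmoothManifolds2013, Cor. 5.30] -/
theorem ambDeriv_eq_fderiv {f : Base g → Base g} {x : Base g}
    {φ : EuclideanSpace ℝ (Fin 4) → EuclideanSpace ℝ (Fin 4)}
    (hf : MDifferentiableAt (𝓡∂ 4) (𝓡∂ 4) f x) (hφ : DifferentiableAt ℝ φ x.1)
    (hfφ : ∀ y, (f y).1 = φ y.1) : ambDeriv g f x = fderiv ℝ φ x.1 := by
  ext1 X
  have hX : X = ambient g x ((ambientEquiv g x).symm X) := (ambient_symm_apply x X).symm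
  set v := (ambientEquiv g x).symm X with hv
  rw [hX, ambDeriv_ambient_eq_mfderiv hf]
  have h1 : HasMFDerivAt (𝓡∂ 4) (𝓡 4) (φ ∘ RegularSublevel.incl (isRegularLevel_rho g)) x
      ((fderiv ℝ φ x.1).comp (ambientCLM g x)) :=
    hφ.hasFDerivAt.hasMFDerivAt.comp x (hasMFDerivAt_incl_base x)
  have heq : RegularSublevel.incl (isRegularLevel_rho g) ∘ f =
      φ ∘ RegularSublevel.incl (isRegularLevel_rho g) := funext hfφ
  rw [heq, h1.mfderiv]
  rfl

/-- The identity has ambient differential the identity. [folklore] -/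
theorem ambDeriv_id (x : Base g) : ambDeriv g id x = ContinuousLinearMap.id ℝ _ := by
  rw [ambDeriv_eq_fderiv (φ := id) mdifferentiableAt_id differentiableAt_id fun _ => rfl, fderiv_id]

/-- The same for `fun y => y`. [folklore] -/
theorem ambDeriv_id' (x : Base g) : ambDeriv g (fun y => y) x = ContinuousLinearMap.id ℝ _ :=
  ambDeriv_id x

/-- **The ambient differential of a local diffeomorphism is injective.** [folklore] -/
theorem injective_ambDeriv {f : Base g → Base g} (hf : IsLocalDiffeomorph (𝓡∂ 4) (𝓡∂ 4) ∞ f)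
    (x : Base g) : Injective (ambDeriv g f x) := by
  intro X Y hXY
  rw [ambDeriv_apply, ambDeriv_apply] at hXY
  have h1 := injective_ambient _ hXY
  have h2 : (ambientEquiv g x).symm X = (ambientEquiv g x).symm Y :=
    ((hf x).mfderivToContinuousLinearEquiv (n := ∞) (by simp)).injective h1
  exact (ambientEquiv g x).symm.injective h2

/-! ## §3 Fibred maps: `d rho` is preserved, the angular form is scaled -/

/-- **A `rho`-preserving map preserves `d rho`**: if `rho (f y) = rho y` for all `y` then
`d rho_{f x} (Λ X) = d rho_x (X)` for `Λ = ambDeriv g f x` and every `X ∈ ℝ⁴`; in particular `Λ`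
maps vectors tangent to `∂ Base g` at `x` to vectors tangent to `∂ Base g` at `f x`. [folklore] -/
theorem fderiv_rho_ambDeriv {f : Base g → Base g} {x : Base g}
    (hf : MDifferentiableAt (𝓡∂ 4) (𝓡∂ 4) f x) (hρ : ∀ y : Base g, rho g (f y).1 = rho g y.1)
    (X : EuclideanSpace ℝ (Fin 4)) :
    fderiv ℝ (rho g) (f x).1 (ambDeriv g f x X) = fderiv ℝ (rho g) x.1 X := by
  have hX : X = ambient g x ((ambientEquiv g x).symm X) := (ambient_symm_apply x X).symm
  set v := (ambientEquiv g x).symm X with hv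
  rw [hX, ambDeriv_ambient_eq_mfderiv hf]
  have hdρ : ∀ q, HasFDerivAt (rho g) (fderiv ℝ (rho g) q) q := fun q =>
    (((contDiff_rho g).differentiable (by simp)) q).hasFDerivAt
  have hinclf : HasMFDerivAt (𝓡∂ 4) (𝓡 4) (RegularSublevel.incl (isRegularLevel_rho g) ∘ f) x
      (mfderiv (𝓡∂ 4) (𝓡 4) (RegularSublevel.incl (isRegularLevel_rho g) ∘ f) x) :=
    (((RegularSublevel.contMDiff_incl (isRegularLevel_rho g)).mdifferentiableAt (by simp)).comp x
      hf).hasMFDerivAt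
  have h1 : HasMFDerivAt (𝓡∂ 4) 𝓘(ℝ, ℝ)
      (rho g ∘ (RegularSublevel.incl (isRegularLevel_rho g) ∘ f)) x
      ((fderiv ℝ (rho g) (f x).1).comp
        (mfderiv (𝓡∂ 4) (𝓡 4) (RegularSublevel.incl (isRegularLevel_rho g) ∘ f) x)) :=
    (hdρ (f x).1).hasMFDerivAt.comp x hinclf
  have h2 : HasMFDerivAt (𝓡∂ 4) 𝓘(ℝ, ℝ) (rho g ∘ RegularSublevel.incl (isRegularLevel_rho g)) x
      ((fderiv ℝ (rho g) x.1).comp (ambientCLM g x)) :=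
    (hdρ x.1).hasMFDerivAt.comp x (hasMFDerivAt_incl_base x)
  have heq : rho g ∘ (RegularSublevel.incl (isRegularLevel_rho g) ∘ f) =
      rho g ∘ RegularSublevel.incl (isRegularLevel_rho g) := funext hρ
  rw [heq] at h1
  have := congrArg (fun L : EuclideanSpace ℝ (Fin 4) →L[ℝ] ℝ => L v) (h1.mfderiv.symm.trans h2.mfderiv)
  exact this

/-- Auxiliary complex algebra: `Im (r w B̄ + w̄ A) = 0` gives `Im (conj (r w) A) = r² Im (w̄ B)`.
[folklore] -/
theorem im_conj_mul_aux {w A B : ℂ} {r : ℝ} (h : ((r : ℂ) * w * conj B + conj w * A).im = 0) :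
    (conj ((r : ℂ) * w) * A).im = r ^ 2 * (conj w * B).im := by
  simp only [Complex.add_im, Complex.mul_im, Complex.mul_re, Complex.conj_re, Complex.conj_im,
    Complex.ofReal_re, Complex.ofReal_im, map_mul, Complex.conj_ofReal] at h ⊢
  linear_combination r * h

/-- **A direction-preserving map scales the angular form by `r²`**: if `w (f y) = r(y) w y` with
`r(y) > 0` for all `y`, then at `x`, with `w (f x) = r w x`:
`Im (w̄(f x) · dw_{f x}(Λ X)) = r² · Im (w̄(x) · dw_x(X))` for `Λ = ambDeriv g f x` and all `X`
(differentiate `Im (w(f y) w̄(y)) ≡ 0`). [cite: EtnyreFuller2006, Thm. 1 (proof, p. 8)] -/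
theorem angle_ambDeriv {f : Base g → Base g} {x : Base g}
    (hf : MDifferentiableAt (𝓡∂ 4) (𝓡∂ 4) f x)
    (hdir : ∀ y : Base g, ∃ r : ℝ, 0 < r ∧ w g (f y).1 = (r : ℂ) * w g y.1) :
    ∃ r : ℝ, 0 < r ∧ w g (f x).1 = (r : ℂ) * w g x.1 ∧
      ∀ X, (conj (w g (f x).1) * (dPhiX g (f x).1 * cx (ambDeriv g f x X) +
          dPhiY (f x).1 * cy (ambDeriv g f x X))).im =
        r ^ 2 * (conj (w g x.1) * (dPhiX g x.1 * cx X + dPhiY x.1 * cy X)).im := by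
  obtain ⟨r, hr, hrw⟩ := hdir x
  refine ⟨r, hr, hrw, fun X => ?_⟩
  have hX : X = ambient g x ((ambientEquiv g x).symm X) := (ambient_symm_apply x X).symm
  set v := (ambientEquiv g x).symm X with hv
  -- the two factors `P y = w (f y)`, `Q y = conj (w y)` and their differentials at `x`
  set P : Base g → ℂ := fun y => w g (f y).1 with hP
  set Q : Base g → ℂ := fun y => conj (w g y.1) with hQ
  have hdw : ∀ q, HasFDerivAt (w g) (fderiv ℝ (w g) q) q := fun q =>
    (((contDiff_w g).differentiable (by simp)) q).hasFDerivAt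
  have hinclf : HasMFDerivAt (𝓡∂ 4) (𝓡 4) (RegularSublevel.incl (isRegularLevel_rho g) ∘ f) x
      (mfderiv (𝓡∂ 4) (𝓡 4) (RegularSublevel.incl (isRegularLevel_rho g) ∘ f) x) :=
    (((RegularSublevel.contMDiff_incl (isRegularLevel_rho g)).mdifferentiableAt (by simp)).comp x
      hf).hasMFDerivAt
  set P' : EuclideanSpace ℝ (Fin 4) →L[ℝ] ℂ := (fderiv ℝ (w g) (f x).1).comp
    (mfderiv (𝓡∂ 4) (𝓡 4) (RegularSublevel.incl (isRegularLevel_rho g) ∘ f) x) with hP'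
  set Q' : EuclideanSpace ℝ (Fin 4) →L[ℝ] ℂ := (Complex.conjCLE.toContinuousLinearMap.comp
    (fderiv ℝ (w g) x.1)).comp (ambientCLM g x) with hQ'
  have hPd : HasMFDerivAt (𝓡∂ 4) 𝓘(ℝ, ℂ) P x P' := (hdw (f x).1).hasMFDerivAt.comp x hinclf
  have hQd : HasMFDerivAt (𝓡∂ 4) 𝓘(ℝ, ℂ) Q x Q' :=
    (Complex.conjCLE.hasFDerivAt.comp x.1 (hdw x.1)).hasMFDerivAt.comp x (hasMFDerivAt_incl_base x)
  have hPQ := hPd.mul hQd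
  -- `Im (P Q) ≡ 0`
  have him0 : (fun y => (Complex.imCLM : ℂ →L[ℝ] ℝ) ((P * Q) y)) = fun _ => 0 := by
    funext y
    obtain ⟨s, _, hs⟩ := hdir y
    show ((w g (f y).1) * conj (w g y.1)).im = 0
    rw [hs, mul_assoc, Complex.mul_conj, Complex.mul_im, Complex.ofReal_re, Complex.ofReal_im]
    simp [Complex.normSq]
  have hIm : HasMFDerivAt (𝓡∂ 4) 𝓘(ℝ, ℝ) (fun y => (Complex.imCLM : ℂ →L[ℝ] ℝ) ((P * Q) y)) x
      ((Complex.imCLM : ℂ →L[ℝ] ℝ).comp (P x • Q' + Q x • P')) :=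
    Complex.imCLM.hasFDerivAt.hasMFDerivAt.comp x hPQ
  rw [him0] at hIm
  have hzero := (hasMFDerivAt_const (I := 𝓡∂ 4) (I' := 𝓘(ℝ, ℝ)) (0 : ℝ) x).mfderiv.symm.trans
    hIm.mfderiv
  have key : ((P x • Q' + Q x • P') v).im = 0 := by
    have h := congrArg (fun L : EuclideanSpace ℝ (Fin 4) →L[ℝ] ℝ => L v) hzero
    exact h.symm
  have hPx : P x = (r : ℂ) * w g x.1 := hrw
  have key' : ((r : ℂ) * w g x.1 * Q' v + conj (w g x.1) * P' v).im = 0 := by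
    have e : (P x • Q' + Q x • P') v = (r : ℂ) * w g x.1 * Q' v + conj (w g x.1) * P' v := by
      rw [← hPx]; rfl
    rw [e] at key
    exact key
  have eQ : Q' v = conj (dPhiX g x.1 * cx (ambient g x v) + dPhiY x.1 * cy (ambient g x v)) := by
    show conj (fderiv ℝ (w g) x.1 (ambient g x v)) = _
    rw [fderiv_w_apply]
  have eP : P' v = dPhiX g (f x).1 *
      cx (mfderiv (𝓡∂ 4) (𝓡 4) (RegularSublevel.incl (isRegularLevel_rho g) ∘ f) x v) +
      dPhiY (f x).1 * cy (mfderiv (𝓡∂ 4) (𝓡 4) (RegularSublevel.incl (isRegularLevel_rho g) ∘ f) x v) := by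
    show fderiv ℝ (w g) (f x).1
      (mfderiv (𝓡∂ 4) (𝓡 4) (RegularSublevel.incl (isRegularLevel_rho g) ∘ f) x v) = _
    rw [fderiv_w_apply]
  rw [eQ, eP] at key'
  -- read off the identity
  rw [hX, ambDeriv_ambient_eq_mfderiv hf, hrw]
  exact im_conj_mul_aux key'

/-! ## §4 The frame data of a fibred map at a flat page point -/

/-- **Sub-goal `helper_ambDeriv_fibred` of stub `stub_T3_dualPresentation`** (T3 ▸ T3c-2 ▸ ST4
`node_ST4_twistSign`, brick X3-2b; wave 5, lead c5): **the frame data of a fibred map.**  Let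
`f : Base g → Base g` be differentiable at `x`, preserve `rho` and the direction of `w`
(`w (f y) = r(y) w y`, `r(y) > 0`).  Let `x` be a flat page point with flat image
(`‖x‖², ‖(f x)‖² < 4` in the `x`-coordinate, `w x ≠ 0`).  Then for `Λ = ambDeriv g f x`:
(i) `⟪Λ X, n(f x)⟫ = κ ⟪X, n(x)⟫` with ONE `κ > 0` for all `X` tangent to `∂ Base g` at `x`
(`d rho_x X = 0`) — the horizontal-normal component is scaled positively; (ii) `Λ` maps the page line
`L_x = ker dΦ_x` into `L_{f x}`. [cite: EtnyreFuller2006, Thm. 1 (proof, p. 8)] -/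
theorem helper_ambDeriv_fibred : ∀ (g : ℕ) (f : Literature.Topology.FourManifolds.LefschetzBase.Base g → Literature.Topology.FourManifolds.LefschetzBase.Base g) (x : Literature.Topology.FourManifolds.LefschetzBase.Base g), MDifferentiableAt (𝓡∂ 4) (𝓡∂ 4) f x → (∀ y : Literature.Topology.FourManifolds.LefschetzBase.Base g, Literature.Topology.FourManifolds.LefschetzBase.rho g (f y).1 = Literature.Topology.FourManifolds.LefschetzBase.rho g y.1) → (∀ y : Literature.Topology.FourManifolds.LefschetzBase.Base g, ∃ r : ℝ, 0 < r ∧ Literature.Topology.FourManifolds.LefschetzBase.w g (f y).1 = (r : ℂ) * Literature.Topology.FourManifolds.LefschetzBase.w g y.1) → ‖Literature.Topology.FourManifolds.LefschetzBase.cx x.1‖ ^ 2 < 4 → ‖Literature.Topology.FourManifolds.LefschetzBase.cx (f x).1‖ ^ 2 < 4 → Literature.Topology.FourManifolds.LefschetzBase.w g x.1 ≠ 0 → (∃ κ : ℝ, 0 < κ ∧ ∀ X : EuclideanSpace ℝ (Fin 4), fderiv ℝ (Literature.Topology.FourManifolds.LefschetzBase.rho g) x.1 X = 0 → inner ℝ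 (Summit.SmoothPoincare4.SmoothPoincare4.Theorems.AcyclicBisectionExists.ModpBraidOrbits.ambDeriv g f x X) (Literature.Topology.FourManifolds.LefschetzBase.horizNormal g (f x).1) = κ * inner ℝ X (Literature.Topology.FourManifolds.LefschetzBase.horizNormal g x.1)) ∧ (∀ X : EuclideanSpace ℝ (Fin 4), Literature.Topology.FourManifolds.LefschetzBase.dPhiX g x.1 * Literature.Topology.FourManifolds.LefschetzBase.cx X + Literature.Topology.FourManifolds.LefschetzBase.dPhiY x.1 * Literature.Topology.FourManifolds.LefschetzBase.cy X = 0 → Literature.Topology.FourManifolds.LefschetzBase.dPhiX g (f x).1 * Literature.Topology.FourManifolds.LefschetzBase.cx (Summit.SmoothPoincare4.SmoothPoincare4.Theorems.AcyclicBisectionExists.ModpBraidOrbits.ambDeriv g f x X) + Literature.Topology.FourManifolds.LefschetzBase.dPhiY (f x).1 * Literature.Topology.FourManifolds.LefschetzBase.cy (Summit.SmoothPoincare4.SmoothPoincare4.Theorems.AcyclicBisectionExists.ModpBraidOrbits.ambDeriv g f x X) = 0) := by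
  intro g f x hf hρ hdir hflat hflat' hw
  obtain ⟨r, hr, hrw, hang⟩ := angle_ambDeriv hf hdir
  have hw' : w g (f x).1 ≠ 0 := by
    rw [hrw]; exact mul_ne_zero (by exact_mod_cast hr.ne') hw
  have hq : (x.1 : EuclideanSpace ℝ (Fin 4)) ≠ 0 := coe_ne_zero x
  have hq' : ((f x).1 : EuclideanSpace ℝ (Fin 4)) ≠ 0 := coe_ne_zero (f x)
  have hN : 0 < ‖dPhiX g x.1‖ ^ 2 + ‖dPhiY x.1‖ ^ 2 :=
    lt_of_le_of_ne (by positivity) (Ne.symm (normSq_dPhi_ne_zero hq))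
  have hN' : 0 < ‖dPhiX g (f x).1‖ ^ 2 + ‖dPhiY (f x).1‖ ^ 2 :=
    lt_of_le_of_ne (by positivity) (Ne.symm (normSq_dPhi_ne_zero hq'))
  -- the tangency `d rho = 0` is `Re (w̄ dΦ) = 0` in the flat region, preserved by `Λ`
  have hre : ∀ X : EuclideanSpace ℝ (Fin 4), fderiv ℝ (rho g) x.1 X = 0 →
      (conj (w g x.1) * (dPhiX g x.1 * cx X + dPhiY x.1 * cy X)).re = 0 ∧
      (conj (w g (f x).1) * (dPhiX g (f x).1 * cx (ambDeriv g f x X) +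
        dPhiY (f x).1 * cy (ambDeriv g f x X))).re = 0 := by
    intro X hX
    have h1 := fderiv_rho_ambDeriv hf hρ X
    rw [hX, fderiv_rho_apply_of_flat hflat'] at h1
    rw [fderiv_rho_apply_of_flat hflat] at hX
    constructor <;> linarith
  refine ⟨⟨r ^ 2 * ((‖dPhiX g x.1‖ ^ 2 + ‖dPhiY x.1‖ ^ 2) /
    (‖dPhiX g (f x).1‖ ^ 2 + ‖dPhiY (f x).1‖ ^ 2)), by positivity, fun X hX => ?_⟩, fun X hX => ?_⟩
  · rw [inner_horizNormal, inner_horizNormal, hang X]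
    field_simp
  · -- `dΦ_x X = 0` gives `d rho X = 0` and `⟪X, n⟫ = 0`, both preserved; hence `dΦ (Λ X) = 0`
    have hρX : fderiv ℝ (rho g) x.1 X = 0 := by
      rw [fderiv_rho_apply_of_flat hflat, hX, mul_zero, Complex.zero_re, mul_zero]
    obtain ⟨-, hre'⟩ := hre X hρX
    have him' : (conj (w g (f x).1) * (dPhiX g (f x).1 * cx (ambDeriv g f x X) +
        dPhiY (f x).1 * cy (ambDeriv g f x X))).im = 0 := by
      rw [hang X, hX, mul_zero, Complex.zero_im, mul_zero]
    have hprod : conj (w g (f x).1) * (dPhiX g (f x).1 * cx (ambDeriv g f x X) +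
        dPhiY (f x).1 * cy (ambDeriv g f x X)) = 0 :=
      Complex.ext (by rw [hre', Complex.zero_re]) (by rw [him', Complex.zero_im])
    exact (mul_eq_zero.1 hprod).resolve_left ((map_ne_zero _).2 hw')

/-! ## §5 Continuity of the ambient differentials of an ambient isotopy at a fixed point -/

/-- **Along an ambient isotopy the ambient differentials at a fixed point vary continuously**:
`t ↦ ambDeriv g (R t) x` is continuous (`ambDeriv g (R t) x X = ambient (dR_t v)` for the fixed chart
vector `v = ambient_x⁻¹ X`, and `(t, θ) ↦ (R_t x, dR_t v)` is continuous into the tangent bundle,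
`continuous_mfderiv_ambientIsotopy_bundle`). [folklore] -/
theorem continuous_ambDeriv_isotopy (R : AmbientIsotopy (𝓡∂ 4) (Base g)) (x : Base g) :
    Continuous fun t : ℝ => ambDeriv g (R.toFun t) x := by
  rw [continuous_clm_apply]
  intro X
  set v := (ambientEquiv g x).symm X with hv
  have hsec : Continuous fun _ : Metric.sphere (0 : EuclideanSpace ℝ (Fin 2)) 1 =>
      (TotalSpace.mk' (EuclideanSpace ℝ (Fin 4)) x v : TangentBundle (𝓡∂ 4) (Base g)) :=
    continuous_const
  have hb := continuous_mfderiv_ambientIsotopy_bundle (L := fun _ => x) (μ := fun _ => v) R hsec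
  have θ₀ : Metric.sphere (0 : EuclideanSpace ℝ (Fin 2)) 1 := circlePt 0
  have h2 : Continuous fun t : ℝ =>
      ambient g (R.toFun t x) (mfderiv (𝓡∂ 4) (𝓡∂ 4) (R.toFun t) x v) :=
    (continuous_ambient.comp hb).comp (continuous_id.prodMk (continuous_const (y := θ₀)))
  exact h2

end Summit.SmoothPoincare4.SmoothPoincare4.Theorems.AcyclicBisectionExists.ModpBraidOrbits

end
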